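import Summits.BirchSwinnertonDyer.BirchSwinnertonDyer.Theorems.SylvesterTwoHeegnerIndexYinIndex
import HarnessLib

/-!
# Route `SylvesterTwoHeegnerIndex` (rung K7t): CONJECTURE C′ and THEOREM C (items 19804 stub (C′) /
# 19802) from ONE `2`-divisible display point per prime — the kernel CONSUMER of a C′ mechanism

HONEST FRAMING (cell b2b-bsdres, seat x1b GEN 52 = O12 class lead; file `--supports
stmt-BirchSwinnertonDyer-19802`; C′ and THEOREM C stay OPEN; nothing here is a mechanism). The cell's
DERIVED-CLAIM OF RECORD for stub (C′) (bsd-cm-two g9, planner D138 (a): «T₂ at the inert supersingular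
prime `2` + a coherent sextic toric period», pending the referee) concludes «Yin's point
`Z_p ∈ 2E_p(K) + tors`» for ONE explicit point carrying Yin's display. The typed conjecture
`SylvesterTwoYin.YinPointTwoDivisibleSevenModNine` (C′) quantifies over EVERY display point `Y`, and
bsd-cm-two g8's `yinPoint_iff_shaAnTwoIntegral_of_yinDisplay` shows C′ ⟺ `0 ≤ ord₂ #Ш_an(E_p)` granted
the display. This file isolates the interface any such mechanism has to meet — whatever its named print
inputs turn out to be (planner D138 (c): `PublishedFactsTwoYinToric`):

* §1 `shaAnTwoIntegralSevenModNine_of_exists_twoDivisible_displayPoint` — if for every `p ≡ 7 (9)` and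
  every minimal `B ≅ E_p` SOME quadratic `K ∋ ω` with `rank_ℤ B(K) = 2`, a rational generator `P`, a
  `2`-adic unit `u` and ONE point `Y ∈ B(K)` with `(u·qB)·ĥ(P) = ¼·ĥ(Y)` AND `Y ∈ 2B(K) + tors` are
  given, then `ShaAnTwoIntegralSevenModNine` (two's `add_two_le_padicValRat_two_of_model_of_twoDivisible`:
  `−2 + 2 ≤ ord₂(u·qB) = ord₂ qB`) — no display fact needed;
* §1 `…_of_forall_field` — the same with `K, ω, rank, P` HANDED OVER (kernel: `K = ℚ(ζ₃)`, rank and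
  generator from Yin's display `YinHeightDisplay`), the provider giving only `Y, u`, display, divisibility;
* §2 `yinPointTwoDivisibleSevenModNine_of_exists_twoDivisible_displayPoint` (C′, granted the display) and
  `hsyPointTwoDivisibleSevenModNine_of_factsPlus_of_exists_twoDivisible_displayPoint` (THE LIVE ITEM 19802
  BY NAME, granted `PublishedFactsTwoPlus` + the display), via two g8's iff and
  `hsyPointTwoDivisibleSevenModNine_of_factsPlus_of_yin`.

* §3 (APPEND) the algebraic skeleton of the mechanism's last step (S5): an ODD multiple `N•Z` that is
  `2•W + torsion` — e.g. `N•Z = −θ(R + cR)` with the anti-trace `R − cR` torsion — is itself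
  `2•Z′ + torsion` (any abelian group).

So once a mechanism delivers ONE `2`-divisible display point per prime (as a kernel theorem modulo named
print facts), C′ and 19802 follow BY NAME through this file; until then nothing is closed.
NO definition, NO named fact, NO sorry; axioms standard; closes no item; nothing booked; no label moves.
References: Yin, arXiv:2607.01744 Thm 1.1, (3.5.3), p. 12 (PRE); [HuShuYin2019] pp. 8, 12; MEMO-bsd-cm-two
v2.9 §42/§46–§49, v2.10 §51 (in preparation); pub/bsd-cm STATUS 2026-08-27T04:58:27Z / D138.
-/

set_option autoImplicit false
-- the Summit-side namespace `Summit.BirchSwinnertonDyer.BirchSwinnertonDyer.…` (summit = problem) is mandated by D-0017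
set_option linter.dupNamespace false

noncomputable section

open scoped Classical

open WeierstrassCurve WeierstrassCurve.Affine WeierstrassCurve.Affine.Point
open Summit.BirchSwinnertonDyer.BirchSwinnertonDyer.Theorems.SylvesterTwoCMNormForm
  Summit.BirchSwinnertonDyer.BirchSwinnertonDyer.Theorems.SylvesterTwoNonneg
  Summit.BirchSwinnertonDyer.BirchSwinnertonDyer.Theorems.SylvesterTwoThmCAssembly
  Summit.BirchSwinnertonDyer.BirchSwinnertonDyer.Theorems.SylvesterTwoYin
  Literature.NumberTheory.EllipticCurves Literature.NumberTheory.EllipticCurves.HuShuYin2019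

namespace Summit.BirchSwinnertonDyer.BirchSwinnertonDyer.Theorems.SylvesterTwoYinOnePoint

/-! ## §1 `0 ≤ ord₂ #Ш_an(E_p)` from ONE `2`-divisible display point per prime -/

/-- **`2`-INTEGRALITY OF `#Ш_an(E_p)` FROM ONE `2`-DIVISIBLE DISPLAY POINT.** If for every prime
`p ≡ 7 (mod 9)` and every globally minimal `B ≅ E_p` with `#Ш_an(B) = qB` one is given a quadratic number
field `K ∋ ω` with `rank_ℤ B(K) = 2`, a rational point `P` generating `B(ℚ)` modulo torsion, a `2`-adic
unit `u ∈ ℚ`, `qB ≠ 0`, and ONE point `Y ∈ B(K)` with `(u·qB)·ĥ(ι P) = 2⁻²·ĥ(Y)` which is `2`-divisible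
modulo torsion, then `0 ≤ ord₂ #Ш_an(E_p)` for all such `p` (`ShaAnTwoIntegralSevenModNine`): the
`2`-divisible point sits in position `i = −2`, so `−2 + 2 ≤ ord₂(u·qB) = ord₂ qB` by the cell's
`add_two_le_padicValRat_two_of_model_of_twoDivisible` (norm form on the `ℤ[ω]`-line, `2` inert). This is
the interface a C′ MECHANISM (one explicit `2`-divisible point, e.g. Yin's `Z_p`) has to meet.
[cite-level reading: arXiv:2607.01744 Thm. 1.1, p. 12; HuShuYin2019 pp. 8, 12] -/
theorem shaAnTwoIntegralSevenModNine_of_exists_twoDivisible_displayPoint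
    (hOne : ∀ (p : ℕ), p.Prime → p % 9 = 7 →
      ∀ (B : WeierstrassCurve ℚ) [B.IsElliptic] [B.IsGloballyMinimal],
      (∃ C : VariableChange ℚ, C • B = cubeSumCurve (p : ℚ)) → ∀ (qB : ℚ), shaAn B = (qB : ℂ) →
      ∃ (K : Type) (_ : Field K) (_ : NumberField K) (ω : K) (_ : ω ^ 2 + ω + 1 = 0)
        (_ : Module.finrank ℚ K = 2) (_ : (B.baseChange K).mordellWeilRank = 2)
        (P : B.toAffine.Point) (_ : ¬ IsOfFinAddOrder (QuadraticDescent.incl K B P))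
        (_ : ∀ Q : B.toAffine.Point, ∃ m : ℤ,
          IsOfFinAddOrder (QuadraticDescent.incl K B Q - m • QuadraticDescent.incl K B P))
        (Y : (B.baseChange K).toAffine.Point) (u : ℚ),
        u ≠ 0 ∧ padicValRat 2 u = 0 ∧ qB ≠ 0 ∧
        ((u * qB : ℚ) : ℝ) * canonicalHeight (QuadraticDescent.incl K B P) =
          (2 : ℝ) ^ (-2 : ℤ) * canonicalHeight Y ∧
        ∃ Y' T' : (B.baseChange K).toAffine.Point, IsOfFinAddOrder T' ∧ Y = (2 : ℤ) • Y' + T') :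
    ShaAnTwoIntegralSevenModNine := by
  intro p hp h7 B _ _ hB qB hqB
  obtain ⟨K, _, _, ω, hω, h2K, hrank, P, hP, hgen, Y, u, hu0, hu, hq0, hid, h2div⟩ :=
    hOne p hp h7 B hB qB hqB
  obtain ⟨C, hC⟩ := hB
  have hp2 : p ≠ 2 := by rintro rfl; norm_num at h7
  have huq : u * qB ≠ 0 := mul_ne_zero hu0 hq0
  have h := add_two_le_padicValRat_two_of_model_of_twoDivisible hω h2K hp hp2 B C hC hrank P hP hgen Y
    huq hid h2div
  rw [padicValRat_two_unit_mul hu0 hq0 hu] at h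
  linarith

/-- **The same with the `K`-layer HANDED OVER.** Granted Yin's display (`YinHeightDisplay`, which
supplies `#Ш_an(B) = qB ≠ 0`, `rank_ℤ B(K) = 2` and a rational generator for EVERY quadratic `K ∋ ω`), it
is enough that the provider produce — for every `p ≡ 7 (9)`, every minimal `B ≅ E_p`, every quadratic
`K ∋ ω` with `rank_ℤ B(K) = 2` and every rational generator `P` handed to it — ONE `2`-divisible point
`Y ∈ B(K)` with a `2`-adic unit `u` and the display `(u·qB)·ĥ(ι P) = 2⁻²·ĥ(Y)`; the kernel takes
`K = ℚ(ζ₃)`. [cite-level reading: arXiv:2607.01744 Thm. 1.1, p. 12; HuShuYin2019 pp. 8, 12] -/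
theorem shaAnTwoIntegralSevenModNine_of_forall_field (hY : YinHeightDisplay)
    (hOneK : ∀ (p : ℕ), p.Prime → p % 9 = 7 →
      ∀ (B : WeierstrassCurve ℚ) [B.IsElliptic] [B.IsGloballyMinimal],
      (∃ C : VariableChange ℚ, C • B = cubeSumCurve (p : ℚ)) → ∀ (qB : ℚ), shaAn B = (qB : ℂ) →
      ∀ (K : Type) [Field K] [NumberField K] (ω : K), ω ^ 2 + ω + 1 = 0 → Module.finrank ℚ K = 2 →
        (B.baseChange K).mordellWeilRank = 2 →
      ∀ (P : B.toAffine.Point), ¬ IsOfFinAddOrder (QuadraticDescent.incl K B P) →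
        (∀ Q : B.toAffine.Point, ∃ m : ℤ,
          IsOfFinAddOrder (QuadraticDescent.incl K B Q - m • QuadraticDescent.incl K B P)) →
      ∃ (Y : (B.baseChange K).toAffine.Point) (u : ℚ), u ≠ 0 ∧ padicValRat 2 u = 0 ∧
        ((u * qB : ℚ) : ℝ) * canonicalHeight (QuadraticDescent.incl K B P) =
          (2 : ℝ) ^ (-2 : ℤ) * canonicalHeight Y ∧
        ∃ Y' T' : (B.baseChange K).toAffine.Point, IsOfFinAddOrder T' ∧ Y = (2 : ℤ) • Y' + T') :
    ShaAnTwoIntegralSevenModNine := by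
  intro p hp h7 B _ _ hB qB hqB
  obtain ⟨ω, hω⟩ := exists_omega_cyclotomicField_three
  have h2K := finrank_cyclotomicField_three
  obtain ⟨qB', hqB', hq0, hrank, P, -, -, -, -, hP, hgen, -⟩ :=
    hY p hp (Or.inr h7) B hB (CyclotomicField 3 ℚ) ω hω h2K
  have e : qB' = qB := by exact_mod_cast hqB'.symm.trans hqB
  subst e
  obtain ⟨Y, u, hu0, hu, hid, h2div⟩ :=
    hOneK p hp h7 B hB qB' hqB (CyclotomicField 3 ℚ) ω hω h2K hrank P hP hgen
  obtain ⟨C, hC⟩ := hB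
  have hp2 : p ≠ 2 := by rintro rfl; norm_num at h7
  have huq : u * qB' ≠ 0 := mul_ne_zero hu0 hq0
  have h := add_two_le_padicValRat_two_of_model_of_twoDivisible hω h2K hp hp2 B C hC hrank P hP hgen Y
    huq hid h2div
  rw [padicValRat_two_unit_mul hu0 hq0 hu] at h
  linarith

/-! ## §2 C′ and the live item 19802 from one `2`-divisible display point per prime -/

/-- **CONJECTURE C′ FROM ONE `2`-DIVISIBLE DISPLAY POINT PER PRIME** (granted Yin's display): by §1 and
two g8's `yinPoint_iff_shaAnTwoIntegral_of_yinDisplay` — if ONE display point is `2`-divisible, EVERY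
display point is (they lie on the same `ℤ[ω]`-line with the same height). C′ stays OPEN; this is the
shape in which a mechanism closes it. [cite-level reading: arXiv:2607.01744 Thm. 1.1, p. 12] -/
theorem yinPointTwoDivisibleSevenModNine_of_forall_field (hY : YinHeightDisplay)
    (hOneK : ∀ (p : ℕ), p.Prime → p % 9 = 7 →
      ∀ (B : WeierstrassCurve ℚ) [B.IsElliptic] [B.IsGloballyMinimal],
      (∃ C : VariableChange ℚ, C • B = cubeSumCurve (p : ℚ)) → ∀ (qB : ℚ), shaAn B = (qB : ℂ) →
      ∀ (K : Type) [Field K] [NumberField K] (ω : K), ω ^ 2 + ω + 1 = 0 → Module.finrank ℚ K = 2 →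
        (B.baseChange K).mordellWeilRank = 2 →
      ∀ (P : B.toAffine.Point), ¬ IsOfFinAddOrder (QuadraticDescent.incl K B P) →
        (∀ Q : B.toAffine.Point, ∃ m : ℤ,
          IsOfFinAddOrder (QuadraticDescent.incl K B Q - m • QuadraticDescent.incl K B P)) →
      ∃ (Y : (B.baseChange K).toAffine.Point) (u : ℚ), u ≠ 0 ∧ padicValRat 2 u = 0 ∧
        ((u * qB : ℚ) : ℝ) * canonicalHeight (QuadraticDescent.incl K B P) =
          (2 : ℝ) ^ (-2 : ℤ) * canonicalHeight Y ∧
        ∃ Y' T' : (B.baseChange K).toAffine.Point, IsOfFinAddOrder T' ∧ Y = (2 : ℤ) • Y' + T') :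
    YinPointTwoDivisibleSevenModNine :=
  (yinPoint_iff_shaAnTwoIntegral_of_yinDisplay hY).mpr (shaAnTwoIntegralSevenModNine_of_forall_field hY hOneK)

/-- **THE LIVE ITEM 19802 (THEOREM C) BY NAME FROM ONE `2`-DIVISIBLE DISPLAY POINT PER PRIME**, granted
the route's support conjunction `PublishedFactsTwoPlus` and Yin's display: §2 + two g8's
`hsyPointTwoDivisibleSevenModNine_of_factsPlus_of_yin`. Nothing is closed (the point is not in the tree).
[cite-level reading: arXiv:2607.01744 Thm. 1.1, p. 12; HuShuYin2019 Thm. 1.4, p. 12] -/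
theorem hsyPointTwoDivisibleSevenModNine_of_factsPlus_of_forall_field
    (hFP : Theses.SylvesterTwoHeegnerIndex.PublishedFactsTwoPlus) (hY : YinHeightDisplay)
    (hOneK : ∀ (p : ℕ), p.Prime → p % 9 = 7 →
      ∀ (B : WeierstrassCurve ℚ) [B.IsElliptic] [B.IsGloballyMinimal],
      (∃ C : VariableChange ℚ, C • B = cubeSumCurve (p : ℚ)) → ∀ (qB : ℚ), shaAn B = (qB : ℂ) →
      ∀ (K : Type) [Field K] [NumberField K] (ω : K), ω ^ 2 + ω + 1 = 0 → Module.finrank ℚ K = 2 →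
        (B.baseChange K).mordellWeilRank = 2 →
      ∀ (P : B.toAffine.Point), ¬ IsOfFinAddOrder (QuadraticDescent.incl K B P) →
        (∀ Q : B.toAffine.Point, ∃ m : ℤ,
          IsOfFinAddOrder (QuadraticDescent.incl K B Q - m • QuadraticDescent.incl K B P)) →
      ∃ (Y : (B.baseChange K).toAffine.Point) (u : ℚ), u ≠ 0 ∧ padicValRat 2 u = 0 ∧
        ((u * qB : ℚ) : ℝ) * canonicalHeight (QuadraticDescent.incl K B P) =
          (2 : ℝ) ^ (-2 : ℤ) * canonicalHeight Y ∧
        ∃ Y' T' : (B.baseChange K).toAffine.Point, IsOfFinAddOrder T' ∧ Y = (2 : ℤ) • Y' + T') :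
    Theses.SylvesterTwoHeegnerIndex.HSYPointTwoDivisibleSevenModNine :=
  hsyPointTwoDivisibleSevenModNine_of_factsPlus_of_yin hFP hY
    (yinPointTwoDivisibleSevenModNine_of_forall_field hY hOneK)

/-! ## §3 APPEND ⟦x1b GEN 52⟧ — the ALGEBRAIC SKELETON of the mechanism's last step (S5): an ODD
multiple that is twice a point modulo torsion is itself twice a point modulo torsion

In bsd-cm-two g9's C′ mechanism (pub/bsd-cm STATUS 2026-08-27T04:58:27Z, steps (S2)/(S5)) the `2`-divisible
point arises as `N·Z_p = −[ζ′](R + cR)` with `N` ODD and the anti-trace `(1 − c)R` TORSION. The passage to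
`Z_p ∈ 2E_p(K) + tors` is pure algebra in any abelian group — recorded here so that the mechanism's typed
inputs need only deliver the CM / automorphic statements (S1), (S3), (S4). -/

/-- **An ODD multiple that is `2W + T` (`T` torsion) is itself `2Z′ + T′`**: with `N = 2k + 1`,
`Z = N•Z − 2k•Z = 2•(W − k•Z) + T`. [folklore] -/
theorem exists_eq_two_smul_add_torsion_of_odd_smul {M : Type*} [AddCommGroup M] {N : ℤ} (hN : Odd N)
    {Z W T : M} (hT : IsOfFinAddOrder T) (h : N • Z = (2 : ℤ) • W + T) :
    ∃ Z' T' : M, IsOfFinAddOrder T' ∧ Z = (2 : ℤ) • Z' + T' := by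
  obtain ⟨k, rfl⟩ := hN
  refine ⟨W - k • Z, T, hT, ?_⟩
  symm
  calc (2 : ℤ) • (W - k • Z) + T = ((2 : ℤ) • W + T) - (2 * k) • Z := by rw [smul_sub, mul_smul]; abel
    _ = (2 * k + 1) • Z - (2 * k) • Z := by rw [h]
    _ = Z := by rw [← sub_smul, add_sub_cancel_left, one_smul]

/-- **The trace form of the last step.** Let `θ` be additive (the CM action `[ζ′]`), `c` any map (complex
conjugation on points) with the ANTI-TRACE `R − cR` torsion, and `N•Z = −θ(R + cR)` with `N` odd. Then
`Z = 2Z′ + T′` with `T′` torsion: `R + cR = 2R − (R − cR)`, so `N•Z = 2•(−θR) + θ(R − cR)`.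
(bsd-cm-two g9 (S2)+(S5): `N·Z_p = −[ζ′](R + cR)`, `(1 − c)R` torsion ⇒ `Z_p ∈ 2E_p(K) + tors`.) [folklore] -/
theorem exists_eq_two_smul_add_torsion_of_odd_smul_eq_neg_trace {M : Type*} [AddCommGroup M]
    (θ : M →+ M) (c : M → M) {N : ℤ} (hN : Odd N) {Z R : M} (hanti : IsOfFinAddOrder (R - c R))
    (h : N • Z = -θ (R + c R)) :
    ∃ Z' T' : M, IsOfFinAddOrder T' ∧ Z = (2 : ℤ) • Z' + T' := by
  refine exists_eq_two_smul_add_torsion_of_odd_smul hN (θ.isOfFinAddOrder hanti) (W := -θ R) ?_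
  rw [h]
  have e : R + c R = (2 : ℤ) • R - (R - c R) := by
    rw [two_smul]; abel
  rw [e, map_sub, map_zsmul, smul_neg, neg_sub']
  abel

end Summit.BirchSwinnertonDyer.BirchSwinnertonDyer.Theorems.SylvesterTwoYinOnePoint

end
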